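import Summits.MatrixMultiplication.OmegaCensus.STPPVosperSlackOneTwoWindows

/-!
# ω-census (abelian STPP census): the slack-1 Vosper law for a block with `b = 2` (two-window side elementary, `Aᵢ`-side modulo Hamidoune–Rødseth) (kernel)

HONEST FRAMING (pub-omega census; verbatim): lottery ticket; floor = certified bounds/negative ranges.
Census STRUCTURE (seat pub-omega-stpp-1 gen 30, 2026-08-28), family (b2).  Variant of `no_isSTPP_of_slack_one_tables_prime_mult`
(`STPPVosperSlackOneLawMult.lean`) for blocks with `b = |Bᵢ| = 2`, where Hamidoune–Rødseth does not apply to the pair `(Bᵢ, V)`: in case β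
(`|Bᵢ + V| = |V| + 2`) the elementary two-run structure (`two_runs_of_card_union_vadd`) makes `V` the union of two maximal `e′`-runs (`Bᵢ = {β, β+e′}`),
transported to two windows carrying the pairs of `W` (`two_windows_ratio_val_mem`, `STPPVosperSlackOneTwoWindows.lean`), and the table is `tableBeta2`.
Cases α and γ are as before (Hamidoune–Rødseth resp. Vosper for `(−Aᵢ, Y°)`, `a ≥ 3`; Vosper for `(Bᵢ, V)`), so the law is STILL CONDITIONAL on
`HamidouneRodsethInverseTheorem` (through case α).  Target `J`: `0`, `±1`, or `±k⁻¹` with `1 ≤ k < a`.  Nothing here is progress on `ω`.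

References: Y. O. Hamidoune, Ø. J. Rødseth, Acta Arith. 92 (2000) 251–262; A. G. Vosper, J. London Math. Soc. 31 (1956); M. B. Nathanson, GTM 165,
Thm 2.7; H. Cohn, R. Kleinberg, B. Szegedy, C. Umans, FOCS 2005 (arXiv:math/0511460), Def. 5.1.
-/

open Finset
open scoped Pointwise

namespace Summit.MatrixMultiplication.OmegaCensus.CubeNB

open Literature.Computability.AlgebraicComplexity
open Literature.Combinatorics.Additive
open Summit.MatrixMultiplication.OmegaCensus.STPPKneser

variable {p : ℕ} [hp : Fact p.Prime]

set_option maxHeartbeats 400000 in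
/-- **The slack-1 Vosper law at prime order for a block with `b = 2`, modulo Hamidoune–Rødseth on the `Aᵢ`-side only (kernel).**  As
`no_isSTPP_of_slack_one_tables_prime_mult` with `b = |Bᵢ| = 2`: in case β the two-run structure of `V` (two windows after transport) replaces Hamidoune–Rødseth
and the case-β table is `tableBeta2 p n m J`; the target `J` has elements `0`, `±1` or `±k⁻¹` (`1 ≤ k < a`).
[cite: CohnKleinbergSzegedyUmans2005, Def. 5.1] [cite: Vosper1956, main theorem; Nathanson1996, Thm 2.7]
[cite: HamidouneRodseth2000, main theorem (§1, p. 252); SerraZemor2000, Theorem 3] -/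
theorem no_isSTPP_of_slack_one_tables_prime_b2 (hHR : HamidouneRodsethInverseTheorem) {N : ℕ} (A B C : Fin N → Finset (ZMod p))
    (hS : IsSTPP A B C) (hA : ∀ k, (A k).Nonempty) (hB : ∀ k, (B k).Nonempty) (hC : ∀ k, (C k).Nonempty)
    (i : Fin N) (hI : ((univ : Finset (Fin N)).erase i).Nonempty)
    {a b vol z L m n : ℕ} (ha : #(A i) = a) (hb : #(B i) = b) (hvol : #(A i) * #(B i) * #(C i) = vol)
    (hz : ∑ k ∈ univ.erase i, #(A k) * #(C k) = z) (hL : ∑ k ∈ univ.erase i, #(B k) * #(C k) = L)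
    (h3a : 3 ≤ a) (h2b : b = 2) (h4z : 4 ≤ z) (h4L : 4 ≤ L) (hslack : z + b + vol + a + L = p + 1)
    (hm : L + a = m + 1) (hn : vol + m = n) {J : Finset ℕ}
    (hJ : ∀ jv ∈ J, jv = 0 ∨ (∃ k ∈ range b, 1 ≤ k ∧ (jv = k ∨ jv + k = p)) ∨ (∃ k ∈ range a, 1 ≤ k ∧ (jv * k % p = 1 ∨ jv * k % p = p - 1)))
    (htableγ : ∀ j < p, ∀ t < p, (∀ i' < m, (t + j * i') % p < n) →
      (∀ k < m, b ∣ (t + j * k) % p - #((range m).filter fun i' => (t + j * i') % p < (t + j * k) % p)) → j ∈ J)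
    (htableα : tableAlpha p (n + 1) (m + 2) b J = true)
    (htableβ : tableBeta2 p n m J = true) : False := by
  have hp2 : 2 ≤ p := hp.out.two_le
  have hcardp : Fintype.card (ZMod p) = p := ZMod.card p
  -- the objects
  set W := ((A i) ×ˢ ((B i) ×ˢ (C i))).image fun q : ZMod p × ZMod p × ZMod p => (0 : ZMod p) + q.2.2 - q.1 - q.2.1 with hW
  set Sn := (A i).image (fun x => (0 : ZMod p) - x) with hSn
  set Yo := DU B C (univ.erase i) with hYo
  set Zo := DU A C (univ.erase i) with hZo
  have hWcard : #W = vol := by rw [hW, card_image_blockSum hS i 0, hvol]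
  have hSncard : #Sn = a := by rw [hSn, Finset.card_image_of_injective _ sub_right_injective, ha]
  have hYocard : #Yo = L := by rw [hYo, card_DU_BC hS hA, hL]
  have hZocard : #Zo = z := by rw [hZo, card_DU_AC hS hB, hz]
  have hSnne : Sn.Nonempty := (hA i).image _
  have hYone : Yo.Nonempty := DU_nonempty hI hB hC
  have hWV : Disjoint W (Sn + Yo) := disjoint_W_negA_add_DU hS i
  have hVcard : #(W ∪ (Sn + Yo)) = vol + #(Sn + Yo) := by rw [Finset.card_union_of_disjoint hWV, hWcard]
  have hsub : B i + (W ∪ (Sn + Yo)) ⊆ univ \ Zo := B_add_W_union_negA_add_subset hS i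
  have hvol1 : 1 ≤ vol := by rw [← hvol]; exact Nat.mul_pos (Nat.mul_pos (hA i).card_pos (hB i).card_pos) (hC i).card_pos
  have hU : #(univ \ Zo) = p - z := by
    rw [Finset.card_sdiff_of_subset (Finset.subset_univ _), Finset.card_univ, hcardp, hZocard]
  have hzle : z ≤ p := by have h := Finset.card_le_univ Zo; rwa [hcardp, hZocard] at h
  have hBV_le : #(B i + (W ∪ (Sn + Yo))) ≤ p - z := hU ▸ Finset.card_le_card hsub
  -- Cauchy–Davenport twice
  have hWne : W.Nonempty := Finset.card_pos.1 (by rw [hWcard]; exact hvol1)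
  have hSY_ne_univ : Sn + Yo ≠ univ := by
    intro h
    obtain ⟨x, hx⟩ := hWne
    exact Finset.disjoint_left.1 hWV hx (h ▸ Finset.mem_univ x)
  have hcd1 : #Sn + #Yo ≤ #(Sn + Yo) + 1 := Vosper.cauchy_davenport_of_ne_univ hSnne hYone hSY_ne_univ
  have hZne : Zo.Nonempty := Finset.card_pos.1 (by rw [hZocard]; omega)
  have hVne : (W ∪ (Sn + Yo)).Nonempty := hWne.mono Finset.subset_union_left
  have hBV_ne_univ : B i + (W ∪ (Sn + Yo)) ≠ univ := by
    intro h
    obtain ⟨x, hx⟩ := hZne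
    have := hsub (h ▸ Finset.mem_univ x)
    rw [Finset.mem_sdiff] at this
    exact this.2 hx
  have hcd2 : #(B i) + #(W ∪ (Sn + Yo)) ≤ #(B i + (W ∪ (Sn + Yo))) + 1 :=
    Vosper.cauchy_davenport_of_ne_univ (hB i) hVne hBV_ne_univ
  rw [hSncard, hYocard] at hcd1
  rw [hb, hVcard] at hcd2
  -- numerology: #(Sn + Yo) ∈ {m, m+1}
  have hSYge : m ≤ #(Sn + Yo) := by omega
  have hSYle : #(Sn + Yo) ≤ m + 1 := by omega
  have hmp : m + 2 ≤ p - 4 := by omega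
  -- pairs at distance k•d in Aᵢ from a structure statement on Sn
  have hApairsE : ∀ {s d : ZMod p} {K μ : ℕ}, 4 ≤ K → Sn = apErase s d K μ →
      ∀ k, 1 ≤ k → k + 2 ≤ K → ∃ α, α ∈ A i ∧ α + k • d ∈ A i := by
    intro s d K μ hK hSnE k hk1 hk
    exact pairs_of_neg_image (A := A) i (a := k + 1) (fun k' hk1' hk' => pairs_of_apErase hSnE hK k' hk1' (by omega)) k hk1 (by omega)
  rcases Nat.eq_or_lt_of_le hSYle with hαcase | hlt
  · /- Case α: the first Cauchy–Davenport step is loose. -/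
    have hVn : #(W ∪ (Sn + Yo)) = n + 1 := by rw [hVcard, hαcase]; omega
    have hBVeq : #(B i + (W ∪ (Sn + Yo))) = p - z := by omega
    have hEq : B i + (W ∪ (Sn + Yo)) = univ \ Zo := Finset.eq_of_subset_of_card_le hsub (by rw [hU, hBVeq])
    -- Vosper for (Bᵢ, V)
    have h2B : 2 ≤ #(B i) := by rw [hb]; omega
    have h2V : 2 ≤ #(W ∪ (Sn + Yo)) := by rw [hVn]; omega
    have hcrit2 : #(B i + (W ∪ (Sn + Yo))) = #(B i) + #(W ∪ (Sn + Yo)) - 1 := by rw [hb, hVn]; omega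
    have hsmall2 : #(B i + (W ∪ (Sn + Yo))) ≤ p - 2 := by omega
    obtain ⟨e', he', hBap, hVap⟩ := vosper_inverse h2B h2V hcrit2 hsmall2
    obtain ⟨β, hβ⟩ := hBap
    obtain ⟨v, hv⟩ := hVap
    rw [hb] at hβ; rw [hVn] at hv
    -- Hamidoune–Rødseth for (Sn, Yo)
    have hHR1 := hHR p Sn Yo (by rw [hSncard]; omega) (by rw [hYocard]; omega) (by omega) (by omega) (by omega)
    obtain ⟨d, s₀, y₀, hSsub, hYsub⟩ := hHR1
    rw [hSncard] at hSsub; rw [hYocard] at hYsub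
    have hd : d ≠ 0 := step_ne_zero_of_subset_apFinset hSsub (by rw [hSncard]; omega)
    have hSYsub : Sn + Yo ⊆ apFinset (s₀ + y₀) d (m + 2) := by
      have h := (Finset.add_subset_add hSsub hYsub).trans (apFinset_add_apFinset_subset s₀ y₀ d (a + 1) (L + 1))
      rwa [show a + 1 + (L + 1) - 1 = m + 2 by omega] at h
    obtain ⟨μ, hμ, hSYE⟩ := eq_apErase_of_subset_apFinset hd (by omega) hSYsub (by rw [hαcase])
    -- pairs in Aᵢ (step multiples of d) and Bᵢ (step multiples of e′)
    obtain ⟨μ₁, -, hSnE⟩ := eq_apErase_of_subset_apFinset hd (by omega : a + 1 ≤ p) hSsub (by rw [hSncard])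
    have hApairs : ∀ k, 1 ≤ k → k < a → ∃ α, α ∈ A i ∧ α + k • d ∈ A i :=
      fun k hk1 hk => hApairsE (by omega) hSnE k hk1 (by omega)
    have hBpairs := pairs_of_apFinset hβ
    obtain ⟨b', rfl⟩ : ∃ b', b = b' + 1 := ⟨b - 1, by omega⟩
    -- transport and table α
    obtain ⟨hSsub', hgap⟩ := prefix_law_of_runs hS i (SY := Sn + Yo) (N₁ := n + 1) he' hβ hWV hv (by omega)
    rw [hSYE, image_affine_apErase] at hSsub' hgap
    have hval := val_mem_of_nat_table_erase_prime (p := p) (n := n + 1) (m := m + 2) (r := b' + 1) (J := J)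
      (by omega) (by omega) (tableAlpha_spec htableα) (mul_ne_zero (inv_ne_zero he') hd) hμ hSsub' hgap
    exact false_of_ratio_val_mem_mult hS i hd he' (by omega) (by omega) hJ hval hApairs hBpairs (hC i)
  · /- Cases β, γ: the first step is tight, Vosper for (Sn, Yo). -/
    have hSYm : #(Sn + Yo) = m := by omega
    have hVn : #(W ∪ (Sn + Yo)) = n := by rw [hVcard, hSYm, hn]
    have h2S : 2 ≤ #Sn := by rw [hSncard]; omega
    have h2Yo : 2 ≤ #Yo := by rw [hYocard]; omega
    have hcrit1 : #(Sn + Yo) = #Sn + #Yo - 1 := by rw [hSncard, hYocard]; omega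
    have hsmall1 : #(Sn + Yo) ≤ p - 2 := by omega
    obtain ⟨d, hd, hSap, hYap⟩ := vosper_inverse h2S h2Yo hcrit1 hsmall1
    obtain ⟨s₀, hs₀⟩ := hSap
    obtain ⟨y₀, hy⟩ := hYap
    rw [hSncard] at hs₀; rw [hYocard] at hy
    have hsubm : Sn + Yo ⊆ apFinset (s₀ + y₀) d m := by
      have h := apFinset_add_apFinset_subset s₀ y₀ d a L
      rw [show a + L - 1 = m by omega] at h
      rwa [hs₀, hy]
    have hSY : Sn + Yo = apFinset (s₀ + y₀) d m :=
      Finset.eq_of_subset_of_card_le hsubm (by rw [hSYm, card_apFinset hd (by omega)])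
    -- pairs in Aᵢ (step multiples of d): Sn is an a-term progression = (a+1)-term one minus its first term
    have hSnE : Sn = apErase (s₀ - d) d (a + 1) 0 := by rw [hs₀, apFinset_eq_apErase_zero]
    have hApairs : ∀ k, 1 ≤ k → k < a → ∃ α, α ∈ A i ∧ α + k • d ∈ A i :=
      fun k hk1 hk => hApairsE (by omega) hSnE k hk1 (by omega)
    rcases Nat.eq_or_lt_of_le hBV_le with hβcase | hγlt
    · /- Case β₂: the second Cauchy–Davenport step is loose; Bᵢ = {β, β + e′} and V is two e′-runs. -/
      obtain ⟨β₁, β₂, hβ12, hBeq⟩ := Finset.card_eq_two.1 (by rw [hb, h2b] : #(B i) = 2)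
      set e' : ZMod p := β₂ - β₁ with he'def
      have he' : e' ≠ 0 := fun h => hβ12 (by rw [he'def] at h; linear_combination -h)
      have hBE : B i = apFinset β₁ e' 2 := by
        rw [hBeq, ← pair_eq_apFinset, he'def, show β₁ + (β₂ - β₁) = β₂ by abel]
      have hBV : B i + (W ∪ (Sn + Yo)) = β₁ +ᵥ ((W ∪ (Sn + Yo)) ∪ (e' +ᵥ (W ∪ (Sn + Yo)))) := by
        rw [hBE, ← pair_eq_apFinset]; exact pair_add_eq_vadd_union β₁ e' _
      have hUcard : #((W ∪ (Sn + Yo)) ∪ (e' +ᵥ (W ∪ (Sn + Yo)))) = #(W ∪ (Sn + Yo)) + 2 := by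
        have h := congrArg Finset.card hBV
        rw [Finset.card_vadd_finset] at h
        rw [← h, hβcase, hVn]; omega
      obtain ⟨v₁, v₂, n₁, n₂, hn1, hn12, hnsum, hVE⟩ := two_runs_of_card_union_vadd he' hUcard
      obtain ⟨hend₁, hend₂⟩ := succ_end_not_mem_of_two_runs hVE hUcard
      rw [hVn] at hnsum
      have hBpairs : ∀ k, 1 ≤ k → k < b → ∃ β, β ∈ B i ∧ β + k • e' ∈ B i := by rw [h2b]; exact pairs_of_apFinset hBE
      -- table β₂
      rw [hVE] at hend₁ hend₂
      have hval := two_windows_ratio_val_mem hS i (J := J) he' hd (by omega) hBE hSY hWV hVE (by rw [hVn]; omega) hend₁ hend₂ (by omega) hn1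
        (by omega)
        (by rw [hnsum]; exact tableBeta2_spec htableβ)
      exact false_of_ratio_val_mem_mult hS i hd he' (by omega) (by omega) hJ hval hApairs hBpairs (hC i)
    · /- Case γ: the inclusion is loose; Vosper for (Bᵢ, V). -/
      have hBVeq : #(B i + (W ∪ (Sn + Yo))) = b + n - 1 := by omega
      have h2B : 2 ≤ #(B i) := by rw [hb]; omega
      have h2V : 2 ≤ #(W ∪ (Sn + Yo)) := by rw [hVn]; omega
      have hcrit2 : #(B i + (W ∪ (Sn + Yo))) = #(B i) + #(W ∪ (Sn + Yo)) - 1 := by rw [hb, hVn]; omega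
      have hsmall2 : #(B i + (W ∪ (Sn + Yo))) ≤ p - 2 := by omega
      obtain ⟨e', he', hBap, hVap⟩ := vosper_inverse h2B h2V hcrit2 hsmall2
      obtain ⟨β, hβ⟩ := hBap
      obtain ⟨v, hv⟩ := hVap
      rw [hb] at hβ; rw [hVn] at hv
      have hBpairs := pairs_of_apFinset hβ
      obtain ⟨b', rfl⟩ : ∃ b', b = b' + 1 := ⟨b - 1, by omega⟩
      obtain ⟨hSsub', hgap⟩ := prefix_law_of_runs hS i (SY := Sn + Yo) (N₁ := n) he' hβ hWV hv (by omega)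
      rw [hSY, image_affine_apFinset] at hSsub' hgap
      have hval := val_mem_of_nat_table_prime (p := p) (n := n) (m := m) (r := b' + 1) (J := J)
        (by omega) (by omega) htableγ (mul_ne_zero (inv_ne_zero he') hd) hSsub' hgap
      exact false_of_ratio_val_mem_mult hS i hd he' (by omega) (by omega) hJ hval hApairs hBpairs (hC i)

end Summit.MatrixMultiplication.OmegaCensus.CubeNB
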